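import Literature.AlgebraicGeometry.Shioda1982.ExceptionalQuadruplesComplete
import HarnessLib

/-!
# Shioda 1982 / Meyer–Neutsch 1981: no exceptional quadruple at the level `N = 540` — kernel sweep, part 9 of 15

Topic `Literature/AlgebraicGeometry/Shioda1982`; companion of `ExceptionalQuadruplesComplete.lean` (search `checkB`, soundness
`tabelleOneCompleteAt_of_chunks`, invariant form `exists_mem_reps_of_isExceptionalQuadruple`, statement `TabelleOneCompleteAt`; sources,
method and framing in its module docstring) and of the series `ExceptionalQuadruplesSweep*.lean` (together: every level `2 ≤ N ≤ 180`
that is not a row of Tabelle 1; `…SweepTwoHundredTwenty/…TwoHundredSixty/…ThreeHundredForty.lean`,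
`…SweepTwoHundredFiftyTwo/…ThreeHundredNinetySix/…FourHundredSixtyEight.lean`, `…SweepTwoHundred.lean`: the levels `220, 260, 340`, `252, 396, 468`
and `200` of the families `20p`, `36p`, `40p`; `…Sweep<Level>[Part<K>].lean` for the `{2,3,5,7}`-smooth residual levels
`189, 192, 210, 216, 224, 240, 270, 288, 300, 315, 320, 324, 336, 360, 378, 384, 405, 420, 432, 448` and now `480 … 630`). THEOREMS only (no definition, no named fact): the same kernel
search at the single level `N = 540`, which carries NO row of [MeyerNeutsch1981Fermatquadrupel, Tabelle 1] (computer-generated there,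
"alle Fermatquadrupel für N ≤ 614 ermittelt", §2 p. 53) and lies above the range `N ≤ 180` of Shioda's table p. 727 — by Aoki's
Theorem C ([Aoki1983], computer-assisted for `181 ≤ m ≤ 672`) there is no exceptional element at any level `> 180`; the files
`ExceptionalQuadruplesSweepFiveHundredFortyPartOne.lean`, `ExceptionalQuadruplesSweepFiveHundredFortyPartTwo.lean`, `ExceptionalQuadruplesSweepFiveHundredFortyPartThree.lean`, `ExceptionalQuadruplesSweepFiveHundredFortyPartFour.lean`, `ExceptionalQuadruplesSweepFiveHundredFortyPartFive.lean`, `ExceptionalQuadruplesSweepFiveHundredFortyPartSix.lean`, `ExceptionalQuadruplesSweepFiveHundredFortyPartSeven.lean`, `ExceptionalQuadruplesSweepFiveHundredFortyPartEight.lean`, `ExceptionalQuadruplesSweepFiveHundredFortyPartNine.lean`, `ExceptionalQuadruplesSweepFiveHundredFortyPartTen.lean`, `ExceptionalQuadruplesSweepFiveHundredFortyPartEleven.lean`, `ExceptionalQuadruplesSweepFiveHundredFortyPartTwelve.lean`, `ExceptionalQuadruplesSweepFiveHundredFortyPartThirteen.lean`, `ExceptionalQuadruplesSweepFiveHundredFortyPartFourteen.lean`,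 `ExceptionalQuadruplesSweepFiveHundredForty.lean` make the instance `N = 540` a kernel statement. The search at
`N = 540` visits 4410495 candidate triples (`φ(540) − 1 = 143` units each), too many for one elaboration of bounded wall time, so the
chunks of first entries are spread over 15 files: `ExceptionalQuadruplesSweepFiveHundredFortyPartOne.lean` — first entries `0 ≤ a < 11` (271951 candidates);
`ExceptionalQuadruplesSweepFiveHundredFortyPartTwo.lean` — first entries `11 ≤ a < 23` (306491 candidates);
`ExceptionalQuadruplesSweepFiveHundredFortyPartThree.lean` — first entries `23 ≤ a < 34` (287321 candidates);
`ExceptionalQuadruplesSweepFiveHundredFortyPartFour.lean` — first entries `34 ≤ a < 45` (290900 candidates);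
`ExceptionalQuadruplesSweepFiveHundredFortyPartFive.lean` — first entries `45 ≤ a < 56` (292040 candidates);
`ExceptionalQuadruplesSweepFiveHundredFortyPartSix.lean` — first entries `56 ≤ a < 67` (290739 candidates);
`ExceptionalQuadruplesSweepFiveHundredFortyPartSeven.lean` — first entries `67 ≤ a < 79` (312819 candidates);
`ExceptionalQuadruplesSweepFiveHundredFortyPartEight.lean` — first entries `79 ≤ a < 90` (280134 candidates);
`ExceptionalQuadruplesSweepFiveHundredFortyPartNine.lean` — first entries `90 ≤ a < 102` (295431 candidates);
`ExceptionalQuadruplesSweepFiveHundredFortyPartTen.lean` — first entries `102 ≤ a < 115` (304500 candidates);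
`ExceptionalQuadruplesSweepFiveHundredFortyPartEleven.lean` — first entries `115 ≤ a < 128` (284403 candidates);
`ExceptionalQuadruplesSweepFiveHundredFortyPartTwelve.lean` — first entries `128 ≤ a < 143` (297923 candidates);
`ExceptionalQuadruplesSweepFiveHundredFortyPartThirteen.lean` — first entries `143 ≤ a < 161` (306399 candidates);
`ExceptionalQuadruplesSweepFiveHundredFortyPartFourteen.lean` — first entries `161 ≤ a < 184` (294253 candidates);
`ExceptionalQuadruplesSweepFiveHundredForty.lean` — first entries `184 ≤ a < 540` (295191 candidates); the last one assembles
`completeAt_fiveHundredForty` (every sorted pair-free primitive Hodge 4-multiset mod `540` is standard) and `not_isExceptionalQuadruple_fiveHundredForty`.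
WHY THIS LEVEL (cell `pub-hfermat`): `540 = 2²·3³·5`: the tree's character-sum families cover the levels `K·p`, `p` a prime above a bound depending on `K`, for
`K ∈ {2, 3, 4, 6, 8, 9, 10, 12, 18, 20, 24, 36, 40}` or `K` a power of `2` or of `3` (`PicardNumber<K>Prime.lean`, `PicardNumberTwoPowerPrime.lean`,
`PicardNumberThreePowPrime.lean`) and the prime-power levels (`PicardNumberPrimePower.lean`); writing `540 = K·p` with `p` prime forces
`K ∈ {108, 180, 270}`, none of them among those `K`. `decide +kernel` only (no `native_decide`).

ASSEMBLY / USE (cell bookkeeping, 2026-08-25): this part is assembled into `completeAt_fiveHundredForty` and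
`not_isExceptionalQuadruple_fiveHundredForty` by `ExceptionalQuadruplesSweepFiveHundredForty.lean`, which the range statement
`ExceptionalQuadruplesNoneUpTo630` (no exceptional quadruple at any level `180 < m < 631`) imports.

HONEST FRAMING (cell `pub-hfermat`): explicit algebraic cycles for specific Hodge classes on Fermat/Delsarte varieties; residual open
instances listed; no claim on general Hodge. These classes are algebraic (Lefschetz (1,1)); certified here is only the emptiness of the
exceptional list at this level.

## References
* [MeyerNeutsch1981Fermatquadrupel] W. Meyer, W. Neutsch, *Fermatquadrupel*, Math. Ann. 256 (1981) 51–62, §2 p. 53, Tabelle 1 p. 54 (no row 540).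
* [Shioda1982PicardFermat] T. Shioda, J. Fac. Sci. Univ. Tokyo IA 28 (1982) 725–734, table p. 727 (levels `≤ 180`), Prop. 4 (Q′) p. 729.
* [Aoki1983] N. Aoki, Math. Ann. 266 (1983) 23–54, Thm. C.
-/

namespace Literature.AlgebraicGeometry.Shioda1982

open Literature.AlgebraicGeometry.HodgeTheory

set_option maxHeartbeats 0 in
/-- **The search at `N = 540` passes on the first entries `90 ≤ a < 102`** (part 9 of 15: 12 chunks, 295431 candidate
triples): every visited sorted quadruple of representatives there fails the Hodge test or is standard (`checkB`; `reps 540 = []`).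
[cite: MeyerNeutsch1981Fermatquadrupel, §2 p. 53 ("alle Fermatquadrupel für N ≤ 614 ermittelt") and Tabelle 1 p. 54 (no row 540)]
[cite: Aoki1983, Thm. C] -/
theorem checkB_fiveHundredForty_partNine :
    ∀ p ∈ ([(90, 1), (91, 1), (92, 1), (93, 1), (94, 1), (95, 1), (96, 1), (97, 1), (98, 1), (99, 1), (100, 1), (101, 1)] : List (ℕ × ℕ)), checkB 540 p.1 p.2 = true := by
  intro p hp
  simp only [List.mem_cons, List.not_mem_nil, or_false] at hp
  rcases hp with rfl | rfl | rfl | rfl | rfl | rfl | rfl | rfl | rfl | rfl | rfl | rfl <;> decide +kernel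

end Literature.AlgebraicGeometry.Shioda1982
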